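import Literature.NumberTheory.EllipticCurves.Kato2004.IwasawaCohomologyTwistLiftTwo
import Literature.NumberTheory.EllipticCurves.Kato2004.IntegralH1CorestrictionMackey
import HarnessLib

/-!
# Kato 2004 §13.1 / Thm. 13.4 at `p = 2`, TRANSPORTED along an identification equivariant only on the levels
# `ℚ(μ_{2^k·∏ℓ})` with `k ≥ 3` (the quadratic twists by `±2`: `√±2 = ζ₈ ± ζ₈⁻¹ ∈ ℚ(μ_8)`): the odd-branch Λ-adic class
# `ỹ ∈ 𝐇¹_Γ(T₂W)` with `ỹ_n = Cor_{ℚ(μ_{2^{n+2}})/ℚ_n}(u_* z′_{n+2,∅})` for every layer `n ≥ 1` is PINNED (norm-compatible, integral,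
# unique; the layer `0` component is forced by the trace `Cor_{ℚ_1/ℚ}`)

Topic `NumberTheory/EllipticCurves`, sub-directory `Kato2004` (namespace = path). THEOREMS ONLY (no `def`, no named fact, no
instance). Cell `bsd-2adic` (run/shared/lean/pub/bsd-2adic/), seat `bsd-2adic-addL2x` GEN 22 (crux stmt-BirchSwinnertonDyer-19098
`AdditiveRankZeroAtTwo`, child C4″ stmt-BirchSwinnertonDyer-22618; reading step T22 (b) of the descent sockets, ODD-BRANCH side, on the
(−2)-split-twist block; repair-census entry R-B85 (2)). Companion of `IwasawaCohomologyTwistLiftTwo.lean` (GEN 21), which pins the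
transported class when `u : T₂A ≃ T₂W` is equivariant on every level `Gal(ℚ̄/ℚ(μ_{2^k·∏ℓ}))` with `k ≥ 2` — the case `A = W^{(−1)}`
(`i ∈ ℚ(μ_4)`). For the twist `A = W^{(−2)}` (or `W^{(2)}`) the identification `T₂A ≅ T₂W` (Silverman X.5 Cor. 5.4) is equivariant
on `Gal(ℚ̄/ℚ(√−2))`, hence on the levels `Gal(ℚ̄/ℚ(μ_{2^k·∏ℓ}))` with `k ≥ 3` ONLY (`√−2 = ζ₈ + ζ₈³`), so the coefficient change
`u_* : H¹(ℚ(μ_{2^{n+2}}), T₂A) → H¹(ℚ(μ_{2^{n+2}}), T₂W)` is available on the layers `n ≥ 1` and NOT on the layer `n = 0` (level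
`ℚ(μ_4) = ℚ(i) ∌ √−2`). THIS FILE pins the transported class in that situation: for an Euler system `z′` for `T₂A` on the levels of
`cyclotomicLevelsRat 2 S`, the family `ỹ_n := Cor_{ℚ(μ_{2^{n+2}})/ℚ_n}(u_* z′_{n+2,∅})` for `n ≥ 1`, completed at `n = 0` by
`ỹ_0 := Cor_{ℚ_1/ℚ}(ỹ_1)`, is norm-compatible (`u_*` commutes with corestriction between levels `≥ 3`, `twistH1On_coresLe`;
transitivity `levelToLayerTwo_layerCores_comm`; the `2`-direction relation `IsEulerSystem.cores_p`) and integral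
(`twistH1On_mem_integralH1`, `coresLe_mem_integralH1`, `layerCores_mem_integralH1`), hence defines a UNIQUE element of any pin
`I : IwasawaH1Data W 2 κ γ` with the displayed components on every layer `n ≥ 1` (two elements of `𝐇¹_Γ` agreeing on all layers
`n ≥ 1` agree on the layer `0` by `cores_proj`). Since `ỹ_0 = Cor_{ℚ(μ_8)/ℚ}(u_* z′_{3,∅})` as well (transitivity + the Euler relation),
nothing is lost: the layer-`0` component simply has no expression through `u_*` at the level `ℚ(μ_4)`.

* `equivariant_level_of_cycSubgroup_three` — from `k ≥ 3` on the `cycSubgroup`s to the levels `(n + 2, ∅)`, `n ≥ 1`;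
* `twistLevelToLayerTwo_layerCores_comm_three` — norm compatibility of the transported family on the layers `n ≥ 1`;
* `IwasawaH1Data.existsUnique_twistLift_of_isEulerSystem_two_three` — the lift from an Euler system `z′` for `T₂A` with integral
  `2`-power classes on the levels `k ≥ 3`;
* `IwasawaH1Data.existsUnique_twistLift_of_zetaBody_two_three` — the lift from a `ZetaBody A 2 f′ …` witness ((C1)+(C2)).
Nothing asserted beyond the displayed hypotheses; BSD is not advanced; nothing is booked.

References: K. Kato, Astérisque 295 (2004) §12.1–12.2 (pp. 219–220), §13.1 and Thm. 13.4 (pp. 224–226), §8.2 (pp. 180–181)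
[Kato2004Asterisque]; K. Rubin, *Euler Systems* (2000) Ch. II §4, Ch. VI [Rubin2000]; J. H. Silverman, *AEC* (2009) X.5 Cor. 5.4
[SilvermanAEC2009]; L. C. Washington, *Introduction to Cyclotomic Fields* §13.1 [Washington1997]; J. Neukirch, A. Schmidt,
K. Wingberg, *Cohomology of Number Fields* I §5 [NeukirchSchmidtWingberg2008]; tree `Kato2004/IwasawaCohomologyTwistLiftTwo.lean`,
`Kato2004/IwasawaCohomologyZetaLiftTwo.lean`, `Kato2004/H1CoefficientChange{,Proofs}.lean`, `Kato2004/IntegralH1CorestrictionMackey.lean`.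
-/

noncomputable section

open scoped NumberField TensorProduct
open Field IsDedekindDomain
open Literature.NumberTheory.GaloisRepresentations
open Literature.NumberTheory.EllipticCurves Literature.NumberTheory.EllipticCurves.Kato2004
open Literature.NumberTheory.EllipticCurves.Kato2004.EulerSystemValues Rat.HeightOneSpectrum

namespace Literature.NumberTheory.EllipticCurves.Kato2004

variable (W : WeierstrassCurve ℚ) [W.IsElliptic] [ContinuousSMul ℤ_[2] (W.tateModule 2)]
  (A' : WeierstrassCurve ℚ) [A'.IsElliptic] [ContinuousSMul ℤ_[2] (A'.tateModule 2)]
  [Module.Free ℤ_[2] (A'.tateModule 2)] [Module.Finite ℤ_[2] (A'.tateModule 2)]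
  (u : A'.tateModule 2 ≃ₗ[ℤ_[2]] W.tateModule 2) (hu : Continuous u)

omit [W.IsElliptic] [ContinuousSMul ℤ_[2] (W.tateModule 2)] [A'.IsElliptic] [ContinuousSMul ℤ_[2] (A'.tateModule 2)]
  [Module.Free ℤ_[2] (A'.tateModule 2)] [Module.Finite ℤ_[2] (A'.tateModule 2)] in
/-- **From the level groups `cycSubgroup 2 k r` (`k ≥ 3`) to the levels `(n + 2, ∅)`, `n ≥ 1`, of `cyclotomicLevelsRat 2 S`**: the two
are the same subgroup `Gal(ℚ̄/ℚ(μ_{2^{n+2}}))` (`cycSubgroup_eq_level`), so an identification `u` equivariant on the former for `k ≥ 3` —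
the shape of the twist identification `T₂W^{(±2)} ≅ T₂W`, equivariant on `Gal(ℚ̄/ℚ(√±2)) ⊇ Gal(ℚ̄/ℚ(μ_8))` — is equivariant on the
level `(n + 2, ∅)` of any `cyclotomicLevelsRat 2 S` as soon as `n ≥ 1`. [cite: Rubin2000, Remark 2.1.4] -/
theorem equivariant_level_of_cycSubgroup_three
    (hV : ∀ k : ℕ, 3 ≤ k → ∀ (r : Finset (HeightOneSpectrum (𝓞 ℚ))) (σ : absoluteGaloisGroup ℚ),
      σ ∈ cycSubgroup 2 k r → ∀ x : A'.tateModule 2, u (σ • x) = σ • u x)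
    (S : Set (HeightOneSpectrum (𝓞 ℚ))) (n : ℕ) (hn : 1 ≤ n) :
    ∀ σ : absoluteGaloisGroup ℚ, σ ∈ (cyclotomicLevelsRat 2 S).level (n + 2) ∅ →
      ∀ x : A'.tateModule 2, u (σ • x) = σ • u x :=
  fun σ hσ x ↦ hV (n + 2) (by omega) ∅ σ (by rw [cycSubgroup_eq_level 2 S (n + 2) ∅]; exact hσ) x

variable {S : Set (HeightOneSpectrum (𝓞 ℚ))}
  (hVS : ∀ (n : ℕ), 1 ≤ n → ∀ (σ : absoluteGaloisGroup ℚ), σ ∈ (cyclotomicLevelsRat 2 S).level (n + 2) ∅ →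
    ∀ x : A'.tateModule 2, u (σ • x) = σ • u x)
  {κ : ZpExtension ℚ 2} (hκ : κ.IsCyclotomic)

/-- **Norm compatibility of the transported family on the layers `n ≥ 1`**: for an Euler system `z′` for `T₂A` on
`cyclotomicLevelsRat 2 S` and `n ≥ 1`, `Cor_{ℚ_{n+1}/ℚ_n}(Cor_{ℚ(μ_{2^{n+3}})/ℚ_{n+1}}(u_* z′_{n+3,∅})) = Cor_{ℚ(μ_{2^{n+2}})/ℚ_n}(u_* z′_{n+2,∅})` —
transitivity of corestriction (`levelToLayerTwo_layerCores_comm`), `u_*` commutes with `Cor_{ℚ(μ_{2^{n+3}})/ℚ(μ_{2^{n+2}})}` (`twistH1On_coresLe`,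
`u` being equivariant on `Gal(ℚ̄/ℚ(μ_{2^{n+2}}))` for `n ≥ 1`), and the `2`-direction Euler-system relation (`IsEulerSystem.cores_p`, no Euler
factor). The level-`≥ 3` twin of `twistLevelToLayerTwo_layerCores_comm`. [cite: Kato2004Asterisque, §13.1 (13.1.1) and Thm. 13.4 (pp. 224–226)]
[cite: Rubin2000, Def. 2.1.1 and Ch. VI] -/
theorem twistLevelToLayerTwo_layerCores_comm_three
    (z' : ∀ (k : ℕ) (r : (cyclotomicLevelsRat 2 S).Ideals), H1 (tateRep A' 2) ((cyclotomicLevelsRat 2 S).level k r.1))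
    (hz' : IsEulerSystem (cyclotomicLevelsRat 2 S) (tateRep A' 2) 2 z') (n : ℕ) (hn : 1 ≤ n) :
    layerCores (tateRep W 2) κ n
        (levelToLayerTwo W hκ S (n + 1)
          (twistH1On W A' u hu (hVS (n + 1) (Nat.le_add_left 1 n)) (z' (n + 3) (cyclotomicLevelsRat 2 S).idealOne))) =
      levelToLayerTwo W hκ S n
        (twistH1On W A' u hu (hVS n hn) (z' (n + 2) (cyclotomicLevelsRat 2 S).idealOne)) := by
  rw [levelToLayerTwo_layerCores_comm W hκ S n]
  congr 1
  -- `coresP ∘ u_* = u_* ∘ coresP` between the levels `n + 3` and `n + 2` (both `≥ 3`), then the Euler-system relation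
  rw [← hz'.cores_p (Nat.le_succ (n + 2)) (cyclotomicLevelsRat 2 S).idealOne]
  unfold EulerSystemLevels.coresP
  letI : Fintype ((cyclotomicLevelsRat 2 S).level (n + 2) ∅ ⧸
      ((cyclotomicLevelsRat 2 S).level (n + 3) ∅).subgroupOf ((cyclotomicLevelsRat 2 S).level (n + 2) ∅)) :=
    Fintype.ofFinite _
  exact (twistH1On_coresLe W A' u hu (hVS n hn)
    ((cyclotomicLevelsRat 2 S).level_mono_left (Nat.le_succ (n + 2)) ∅) ((cyclotomicLevelsRat 2 S).isOpen_level (n + 3) ∅)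
    (z' (n + 3) (cyclotomicLevelsRat 2 S).idealOne)).symm

variable {γ : absoluteGaloisGroup ℚ} (I : IwasawaH1Data W 2 κ γ)

/-- **The TRANSPORTED Λ-adic class is pinned from the layer `1` on (Kato §13.1 / Thm. 13.4 at `p = 2`, along `u : T₂A ≃ T₂W` equivariant
on the levels `k ≥ 3`).** For an Euler system `z′` for `T₂A` on the levels of `cyclotomicLevelsRat 2 S`, GRANTED that the classes
`Cor_{ℚ(μ_{2^{n+2}})/ℚ_n}(u_* z′_{n+2,∅})`, `n ≥ 1`, are integral (`hint`), there is a UNIQUE `ỹ ∈ 𝐇¹_Γ(T₂W)` (the pinned `IwasawaH1Data` of `W`)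
with `proj_n ỹ = Cor_{ℚ(μ_{2^{n+2}})/ℚ_n}(u_* z′_{n+2,∅})` for every `n ≥ 1`. Existence: the family completed by `ỹ_0 := Cor_{ℚ_1/ℚ}(ỹ_1)` is
norm-compatible (`twistLevelToLayerTwo_layerCores_comm_three`) and integral (`layerCores_mem_integralH1` at `n = 0`); uniqueness: two
elements agreeing on every layer `n ≥ 1` agree on the layer `0` (`cores_proj`), hence everywhere (`ext_of_proj`).
[cite: Kato2004Asterisque, §13.1 and Thm. 13.4 (pp. 224–226), §12.2 (p. 220)] [cite: Rubin2000, Ch. VI] -/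
theorem IwasawaH1Data.existsUnique_twistLift_of_isEulerSystem_two_three
    (z' : ∀ (k : ℕ) (r : (cyclotomicLevelsRat 2 S).Ideals), H1 (tateRep A' 2) ((cyclotomicLevelsRat 2 S).level k r.1))
    (hz' : IsEulerSystem (cyclotomicLevelsRat 2 S) (tateRep A' 2) 2 z')
    (hint : ∀ (n : ℕ) (hn : 1 ≤ n), levelToLayerTwo W hκ S n
      (twistH1On W A' u hu (hVS n hn) (z' (n + 2) (cyclotomicLevelsRat 2 S).idealOne)) ∈
        integralH1 (tateRep W 2) 2 (κ.layerSubgroup n)) :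
    ∃! y : I.H, ∀ (n : ℕ) (hn : 1 ≤ n), I.proj n y = levelToLayerTwo W hκ S n
      (twistH1On W A' u hu (hVS n hn) (z' (n + 2) (cyclotomicLevelsRat 2 S).idealOne)) := by
  -- the transported family on the layers `n ≥ 1`, completed at `n = 0` by the trace
  let F : ∀ n : ℕ, 1 ≤ n → H1 (tateRep W 2) (κ.layerSubgroup n) := fun n hn ↦
    levelToLayerTwo W hκ S n (twistH1On W A' u hu (hVS n hn) (z' (n + 2) (cyclotomicLevelsRat 2 S).idealOne))
  let Y : ∀ n : ℕ, H1 (tateRep W 2) (κ.layerSubgroup n) := fun n ↦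
    match n with
    | 0 => layerCores (tateRep W 2) κ 0 (F 1 le_rfl)
    | m + 1 => F (m + 1) (Nat.le_add_left 1 m)
  have hYsucc : ∀ m : ℕ, Y (m + 1) = F (m + 1) (Nat.le_add_left 1 m) := fun m ↦ rfl
  have hY0 : Y 0 = layerCores (tateRep W 2) κ 0 (F 1 le_rfl) := rfl
  have hYF : ∀ (n : ℕ) (hn : 1 ≤ n), Y n = F n hn := by
    intro n hn
    obtain ⟨m, rfl⟩ : ∃ m, n = m + 1 := ⟨n - 1, by omega⟩
    exact hYsucc m
  have hnc : IsNormCompatible (tateRep W 2) κ Y := by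
    refine ⟨fun n ↦ ?_, fun n ↦ ?_⟩
    · -- integrality
      rcases n with _ | m
      · rw [hY0]
        exact layerCores_mem_integralH1 (tateRep W 2) κ 0 (hint 1 le_rfl)
      · rw [hYsucc]
        exact hint (m + 1) (Nat.le_add_left 1 m)
    · -- norm compatibility
      rcases n with _ | m
      · rfl
      · rw [hYsucc, hYsucc]
        exact twistLevelToLayerTwo_layerCores_comm_three W A' u hu hVS hκ z' hz' (m + 1) (Nat.le_add_left 1 m)
  obtain ⟨y, hy, huniq⟩ := I.exists_unique_lift hnc
  refine ⟨y, fun n hn ↦ ?_, fun y' hy' ↦ ?_⟩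
  · rw [hy n, hYF n hn]
  · refine I.ext_of_proj fun n ↦ ?_
    rcases n with _ | m
    · -- the layer `0`: forced by the traces from the layer `1`
      rw [← I.cores_proj 0 y', ← I.cores_proj 0 y, hy' 1 le_rfl, hy 1]
    · rw [hy' (m + 1) (Nat.le_add_left 1 m), hy (m + 1)]

/-- **The transported zeta class at `p = 2` from a `ZetaBody` witness of the OTHER curve, along an identification equivariant on the
levels `k ≥ 3`.** Let `(κ', Λ', z′, x′)` satisfy `ZetaBody A 2 f′ ι κ' Λ' c d a A z′ x′` (Kato's Euler system for `T₂A` with its values —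
e.g. `A = W^{(−2)}`, `f′` its newform) and let `u : T₂A ≃ T₂W` be continuous and equivariant on the levels `Gal(ℚ̄/ℚ(μ_{2^k·∏ℓ}))`, `k ≥ 3`.
Then for any cyclotomic `ℤ₂`-tower datum `I : IwasawaH1Data W 2 κ γ` there is a UNIQUE `ỹ ∈ 𝐇¹_Γ(T₂W)` whose `n`-th layer component is
`Cor_{ℚ(μ_{2^{n+2}})/ℚ_n}(u_* z′_{n+2,∅})` for every `n ≥ 1`: (C1) gives the norm compatibility, (C2) with `twistH1On_mem_integralH1` and
`coresLe_mem_integralH1` (the level is normal and unramified away from `2`) the integrality. This is the class the descent sockets of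
crux 19098 call `z̃` on the (−2)-split-twist block (the odd-branch transport of `z(f_{W^{(−2)}})`). No hypothesis beyond the witness and `u`;
nothing asserted. [cite: Kato2004Asterisque, §13.1 and Thm. 13.4 (pp. 224–226), §12.1–12.2 (pp. 219–220), §8.2 (pp. 180–181)]
[cite: Rubin2000, Ch. VI] [cite: Washington1997, §13.1] -/
theorem IwasawaH1Data.existsUnique_twistLift_of_zetaBody_two_three
    (hV : ∀ k : ℕ, 3 ≤ k → ∀ (r : Finset (HeightOneSpectrum (𝓞 ℚ))) (σ : absoluteGaloisGroup ℚ),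
      σ ∈ cycSubgroup 2 k r → ∀ x : A'.tateModule 2, u (σ • x) = σ • u x)
    {N' : ℕ} (f' : CuspForm (CongruenceSubgroup.Gamma0 N') 2)
    (ι : (m : ℕ) → (CyclotomicField m ℚ →+* ℂ)) (κ' : ℝ)
    (Λ' : ∀ (k : ℕ) (r : Finset (HeightOneSpectrum (𝓞 ℚ))),
      H1 (tateRep A' 2) (cycSubgroup 2 k r) →ₗ[ℤ_[2]] ℚ_[2] ⊗[ℚ] CyclotomicField (cycLevel 2 k r) ℚ)
    (c d a : ℤ) (A : ℕ)
    (z' : ∀ (k : ℕ) (r : (cyclotomicLevelsRat 2 (badPlaces c d A N')).Ideals),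
      H1 (tateRep A' 2) ((cyclotomicLevelsRat 2 (badPlaces c d A N')).level k r.1))
    (x' : ∀ (k : ℕ) (r : (cyclotomicLevelsRat 2 (badPlaces c d A N')).Ideals), CyclotomicField (cycLevel 2 k r.1) ℚ)
    (hbody : ZetaBody A' 2 f' ι κ' Λ' c d a A z' x') :
    ∃! y : I.H, ∀ (n : ℕ) (hn : 1 ≤ n), I.proj n y = levelToLayerTwo W hκ (badPlaces c d A N') n
      (twistH1On W A' u hu (equivariant_level_of_cycSubgroup_three W A' u hV (badPlaces c d A N') n hn)
        (z' (n + 2) (cyclotomicLevelsRat 2 (badPlaces c d A N')).idealOne)) := by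
  refine IwasawaH1Data.existsUnique_twistLift_of_isEulerSystem_two_three W A' u hu
    (equivariant_level_of_cycSubgroup_three W A' u hV (badPlaces c d A N')) hκ I z' hbody.1 fun n hn ↦ ?_
  -- integrality: (C2) for `z′`, `u_*` preserves integrality, `Cor` preserves integrality
  haveI : ((cyclotomicLevelsRat 2 (badPlaces c d A N')).level (n + 2) ∅).Normal :=
    normal_cyclotomicLevelsRat_level_empty 2 (badPlaces c d A N') (n + 2)
  haveI : ((cyclotomicLevelsRat 2 (badPlaces c d A N')).level (n + 2) ∅).FiniteIndex :=
    finiteIndex_of_isOpen_of_compactSpace _ ((cyclotomicLevelsRat 2 (badPlaces c d A N')).isOpen_level (n + 2) ∅)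
  haveI : Fintype (κ.layerSubgroup n ⧸
      ((cyclotomicLevelsRat 2 (badPlaces c d A N')).level (n + 2) ∅).subgroupOf (κ.layerSubgroup n)) := Fintype.ofFinite _
  have hz : z' (n + 2) (cyclotomicLevelsRat 2 (badPlaces c d A N')).idealOne ∈
      integralH1 (tateRep A' 2) 2 ((cyclotomicLevelsRat 2 (badPlaces c d A N')).level (n + 2) ∅) :=
    fun v hv 𝔓 h𝔓 ↦ hbody.2.1 (n + 2) (cyclotomicLevelsRat 2 (badPlaces c d A N')).idealOne v hv 𝔓 h𝔓
  have huz := twistH1On_mem_integralH1 W A' u hu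
    (equivariant_level_of_cycSubgroup_three W A' u hV (badPlaces c d A N') n hn) hz
  have key := coresLe_mem_integralH1 (tateRep W 2) 2
    (hκ.cyclotomicLevelsRat_level_le_layerSubgroup_two (badPlaces c d A N') n)
    ((cyclotomicLevelsRat 2 (badPlaces c d A N')).isOpen_level (n + 2) ∅)
    (fun v hv ↦ cyclotomicLevelsRat_level_empty_unramifiedAt 2 (badPlaces c d A N') (n + 2) v hv) huz
  unfold levelToLayerTwo
  convert key using 4

end Literature.NumberTheory.EllipticCurves.Kato2004

end
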